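import Summits.QuantumFields.YangMills.Theorems.UnitScaleTiltProp7PinnedBiharmonicAgmonDecay
import HarnessLib

/-!
# Route `UnitScaleTilt`, crux K1 «MinimiserStabilityRegPr» (stmt-QuantumFields-19200), route-R E′ path (α′), sup row (hK) — (D2′) AGMON, FILE 4∕4:
# THE NUMERIC WINDOW.  `a|c|√d·√A ≤ 1∕100` and `b·c²·d·A ≤ 1∕50` discharge the two smallness rows `H1`, `H2` of ✓ `…AgmonDecay.weighted_laplace_le_core`
# with ABSOLUTE constants: `‖ωΔe‖ ≤ 3‖ωh‖ + 5√A‖ωh̃‖ + 5A‖ωs‖`, `‖ωe‖ ≤ 3A‖ωΔe‖`, `‖ω∂e‖ ≤ 3√A‖ωΔe‖`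

Cell `ym3-torus`, D-0154 (3c) width seat `ym-routeR-w6` (gen 5), on ★routeR-w3 g5's «routeR-w6: GO (D2′)» 2026-08-28T18:22:37Z (interface (1)–(4) of
that line); `--supports stmt-QuantumFields-19200`, count-neutral.  THEOREMS ONLY (0 `def`, 0 `sorry`).  YM₃ on T³ is a ladder rung (R3), not the
Clay problem; nothing here claims the stub, the crux, d = 4 or the gap.

THE POINT.  The consumer ((A) of the routeR-w3 lineage) should not redo the `√10`, `√3`, `A′ ≤ 2.01A`, `g₁ ≤ 2.01√A` arithmetic: with the weight
`ω = exp(κρ∕ℓ)` (`a = 2κ∕ℓ`, `b = 3κ∕ℓ²`) and `A = √C_P·ℓ²` the window reads `κ ≤ min(1∕(200|c|√d·C_P^{1∕4}), 1∕(150c²d√C_P))` — an absolute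
`κ = κ(C_P, d, c)`, i.e. exponential screening at rate `κ∕ℓ` with L-only constants once `C_P` is (routeR-w2's (D1-glob)).

WHAT IS PROVED (ns `…Theorems.Prop7PinnedBiharmonicAgmonWindow`).
* `sqrt_ten_le` (`√10 ≤ 16∕5`, `√3 ≤ 7∕4`), ★★★ `weighted_laplace_le_window` — `weighted_laplace_le_core` under the window, constants `3, 5√A, 5A ∕ 3A ∕ 3√A`.
HONEST SCOPE.  Arithmetic only (`t := a|c|√d√A`: `p = √10·√A·t`, `pγ = (15√10∕4)t²`, `p² = 10At²`, `A′ ≤ 2.01A`, `γA′ ≤ 0.08√A`, `g₁ ≤ 2.01√A`,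
`τ ≤ 0.31`); everything displayed in file 3 stays displayed ((D1-glob) root form, the weight rows, the EL identity).

References: T. Bałaban, CMP 96 (1984) 223–250 [Balaban1984PropagatorsII] ((1.9) p.226).
-/

set_option autoImplicit false

noncomputable section

open scoped BigOperators

namespace Summit.QuantumFields.YangMills.Theorems.Prop7PinnedBiharmonicAgmonWindow

open Literature.MathematicalPhysics.QuantumFieldTheory.Balaban1983to89
open Finset LatticeFieldCalculus
open B10StarCount (sum_pbond shift_unshift unshift_shift)
open Summit.QuantumFields.YangMills.Theorems.Prop7CentreHarmonicInterpKernel (sum_comp_shift sum_comp_unshift' laplace_sub')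
open Summit.QuantumFields.YangMills.Theorems.Prop7PinnedHodgeSplit (sum_mul_laplace_eq_sum_grad_mul sum_mul_laplace_comm)
open Summit.QuantumFields.YangMills.Theorems.Prop7PinnedBiharmonicAgmonLetters
open Summit.QuantumFields.YangMills.Theorems.Prop7PinnedBiharmonicAgmonInterp
open Summit.QuantumFields.YangMills.Theorems.Prop7PinnedBiharmonicAgmonDecay

variable {P : Params} {j : ℕ}

/-! ## §8 A numeric window: `t = a|c|√d·√A ≤ 1/100`, `u = b·c²·d·A ≤ 1/50` discharge `H1`, `H2` with absolute constants -/

/-- numerics: `√10 ≤ 16/5`, `√3 ≤ 7/4`. [folklore] -/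
theorem sqrt_ten_le : Real.sqrt 10 ≤ 16 / 5 ∧ Real.sqrt 3 ≤ 7 / 4 := by
  constructor
  · rw [Real.sqrt_le_left (by norm_num)]; norm_num
  · rw [Real.sqrt_le_left (by norm_num)]; norm_num

set_option maxHeartbeats 400000 in
/-- ★★★ **(D2′) AGMON, NUMERIC WINDOW.**  Same data as `weighted_laplace_le_core`, with the two smallness rows replaced by the window
`a|c|√d·√A ≤ 1/100`, `b·c²·d·A ≤ 1/50` (with `a = 2κ/ℓ`, `b = 3κ/ℓ²`, `A = √C_P·ℓ²`: `κ·(2|c|√d·C_P^{1/4}) ≤ 1/100` and `κ·(3c²d√C_P) ≤ 1/50`).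
Conclusion with absolute constants: `‖ωΔe‖ ≤ 3‖ωh‖ + 5√A·‖ωh̃‖ + 5A·‖ωs‖`, `‖ωe‖ ≤ 3A·‖ωΔe‖`, `‖ω∂e‖ ≤ 3√A·‖ωΔe‖`. [folklore] -/
theorem weighted_laplace_le_window (c : ℝ) (C : Set (Site P j)) (ω e h s : SiteField P j ℝ) (ht : VecField P j ℝ)
    {a b A : ℝ} (ha0 : 0 ≤ a) (hb0 : 0 ≤ b) (hA : 0 ≤ A)
    (hω₀ : ∀ x, 0 < ω x)
    (hω₁ : ∀ x μ, |ω (x.shift μ) - ω x| ≤ a * ω x ∧ |ω (x.unshift μ) - ω x| ≤ a * ω x)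
    (hω₂ : ∀ x μ, |ω (x.shift μ) + ω (x.unshift μ) - 2 * ω x| ≤ b * ω x)
    (hP : ∀ v : SiteField P j ℝ, (∀ y ∈ C, v y = 0) →
      Real.sqrt (∑ x, v x ^ 2) ≤ A * Real.sqrt (∑ x, laplace c v x ^ 2))
    (he : ∀ y ∈ C, e y = 0)
    (hEL : ∀ v : SiteField P j ℝ, (∀ y ∈ C, v y = 0) →
      ∑ x, laplace c e x * laplace c v x = ∑ x, h x * laplace c v x + ∑ b, ht b * grad c v b + ∑ x, s x * v x)
    (ha : a ≤ 1 / 2) (hwin₁ : a * |c| * Real.sqrt P.d * Real.sqrt A ≤ 1 / 100) (hwin₂ : b * c ^ 2 * P.d * A ≤ 1 / 50) :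
    Real.sqrt (∑ x, (ω x * laplace c e x) ^ 2)
        ≤ 3 * Real.sqrt (∑ x, (ω x * h x) ^ 2) + 5 * Real.sqrt A * Real.sqrt (∑ b, (ω b.src * ht b) ^ 2)
          + 5 * A * Real.sqrt (∑ x, (ω x * s x) ^ 2)
      ∧ Real.sqrt (∑ x, (ω x * e x) ^ 2) ≤ 3 * A * Real.sqrt (∑ x, (ω x * laplace c e x) ^ 2)
      ∧ Real.sqrt (∑ b, (ω b.src * grad c e b) ^ 2) ≤ 3 * Real.sqrt A * Real.sqrt (∑ x, (ω x * laplace c e x) ^ 2) := by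
  have hd : (0 : ℝ) ≤ P.d := Nat.cast_nonneg _
  obtain ⟨hs10, hs3⟩ := sqrt_ten_le
  have hs10' : (3 : ℝ) ≤ Real.sqrt 10 := by rw [Real.le_sqrt (by norm_num) (by norm_num)]; norm_num
  have hs3' : 0 ≤ Real.sqrt 3 := Real.sqrt_nonneg _
  set sA := Real.sqrt A with hsA
  set sd := Real.sqrt (P.d : ℝ) with hsd
  have hsA0 : 0 ≤ sA := Real.sqrt_nonneg _
  have hsd0 : 0 ≤ sd := Real.sqrt_nonneg _
  have hsA2 : sA ^ 2 = A := Real.sq_sqrt hA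
  have hsd2 : sd ^ 2 = P.d := Real.sq_sqrt hd
  have hsqrt10d : Real.sqrt (10 * P.d) = Real.sqrt 10 * sd := Real.sqrt_mul (by norm_num) _
  -- the two window quantities
  set t := a * |c| * sd * sA with htdef
  have ht0 : 0 ≤ t := by positivity
  have ht1 : t ≤ 1 / 100 := hwin₁
  have ht2 : t ^ 2 = a ^ 2 * c ^ 2 * P.d * A := by rw [htdef]; simp only [mul_pow, sq_abs, hsA2, hsd2]
  set u := b * c ^ 2 * P.d * A with hudef
  have hu0 : 0 ≤ u := by positivity
  have hu1 : u ≤ 1 / 50 := hwin₂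
  -- the derived constants
  set p := Real.sqrt (10 * P.d) * A * a * |c| with hp
  set γ := 15 / 4 * a * |c| * Real.sqrt P.d with hγ
  set A' := 2 * A + 4 * p ^ 2 with hA'
  set g₁ := Real.sqrt (2 * A' + γ ^ 2 * A' ^ 2) with hg₁
  set τ := Real.sqrt (10 * P.d) * (5 / 2 * a) * |c| * g₁ + Real.sqrt 3 * P.d * (2 * a ^ 2 + 2 * b) * c ^ 2 * A' with hτ
  have hp' : p = Real.sqrt 10 * sA * t := by
    rw [hp, hsqrt10d, htdef]
    have : A = sA * sA := by rw [← sq, hsA2]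
    rw [this]; ring
  have hpγ : p * γ = 15 / 4 * Real.sqrt 10 * t ^ 2 := by
    rw [hp', hγ, ← hsd]
    have e1 : Real.sqrt 10 * sA * t * (15 / 4 * a * |c| * sd) = 15 / 4 * Real.sqrt 10 * t * (a * |c| * sd * sA) := by ring
    rw [e1, ← htdef]; ring
  have hp2 : p ^ 2 = 10 * A * t ^ 2 := by
    rw [hp', mul_pow, mul_pow, Real.sq_sqrt (by norm_num), hsA2]
  have ht2le : t ^ 2 ≤ 1 / 10000 := by nlinarith
  have hA'le : A' ≤ 201 / 100 * A := by
    have h1 : A * t ^ 2 ≤ A * (1 / 10000) := mul_le_mul_of_nonneg_left ht2le hA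
    rw [hA', hp2]; linarith
  have hA'0 : 0 ≤ A' := by rw [hA']; positivity
  have hγ0 : 0 ≤ γ := by rw [hγ]; positivity
  have hγA' : γ * A' ≤ 8 / 100 * sA := by
    have h1 : γ * A' ≤ γ * (201 / 100 * A) := mul_le_mul_of_nonneg_left hA'le hγ0
    have h2 : γ * (201 / 100 * A) = 201 / 100 * (15 / 4) * (t * sA) := by
      rw [hγ, ← hsd, htdef]
      have : A = sA * sA := by rw [← sq, hsA2]
      rw [this]; ring
    have h3 : t * sA ≤ 1 / 100 * sA := mul_le_mul_of_nonneg_right ht1 hsA0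
    rw [h2] at h1
    linarith
  have hγA'0 : 0 ≤ γ * A' := by positivity
  have hg₁le : g₁ ≤ 201 / 100 * sA := by
    rw [hg₁, Real.sqrt_le_left (by positivity)]
    have h1 : γ ^ 2 * A' ^ 2 = (γ * A') ^ 2 := by ring
    have h2 : (γ * A') ^ 2 ≤ (8 / 100 * sA) ^ 2 := pow_le_pow_left₀ hγA'0 hγA' 2
    have h3 : A' ≤ 201 / 100 * sA ^ 2 := by rw [hsA2]; exact hA'le
    have e1 : (8 / 100 * sA) ^ 2 = 64 / 10000 * sA ^ 2 := by ring
    have e2 : (201 / 100 * sA) ^ 2 = 40401 / 10000 * sA ^ 2 := by ring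
    rw [h1, e2]; rw [e1] at h2
    linarith
  have hg₁0 : 0 ≤ g₁ := Real.sqrt_nonneg _
  -- H1 and H2
  have H1 : p * γ + Real.sqrt 3 * P.d * b * c ^ 2 * A ≤ 1 / 4 := by
    rw [hpγ]
    have e1 : Real.sqrt 3 * P.d * b * c ^ 2 * A = Real.sqrt 3 * u := by rw [hudef]; ring
    rw [e1]
    have h1 : Real.sqrt 10 * t ^ 2 ≤ 16 / 5 * (1 / 10000) := mul_le_mul hs10 ht2le (sq_nonneg t) (by norm_num)
    have h2 : Real.sqrt 3 * u ≤ 7 / 4 * (1 / 50) := mul_le_mul hs3 hu1 hu0 (by norm_num)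
    linarith
  have H2 : τ ≤ 1 / 2 := by
    rw [hτ, hsqrt10d]
    have e1 : Real.sqrt 10 * sd * (5 / 2 * a) * |c| * g₁ = 5 / 2 * Real.sqrt 10 * (a * |c| * sd) * g₁ := by ring
    have e2 : Real.sqrt 3 * P.d * (2 * a ^ 2 + 2 * b) * c ^ 2 * A' = 2 * Real.sqrt 3 * ((a ^ 2 * c ^ 2 * P.d + b * c ^ 2 * P.d) * A') := by
      ring
    rw [e1, e2]
    have hacd : 0 ≤ a * |c| * sd := by positivity
    have h1 : (a * |c| * sd) * g₁ ≤ (a * |c| * sd) * (201 / 100 * sA) := mul_le_mul_of_nonneg_left hg₁le hacd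
    have h1' : (a * |c| * sd) * (201 / 100 * sA) = 201 / 100 * t := by rw [htdef]; ring
    have h2 : (a ^ 2 * c ^ 2 * P.d + b * c ^ 2 * P.d) * A' ≤ (a ^ 2 * c ^ 2 * P.d + b * c ^ 2 * P.d) * (201 / 100 * A) :=
      mul_le_mul_of_nonneg_left hA'le (by positivity)
    have h2' : (a ^ 2 * c ^ 2 * P.d + b * c ^ 2 * P.d) * (201 / 100 * A) = 201 / 100 * (t ^ 2 + u) := by rw [ht2, hudef]; ring
    have h3 : Real.sqrt 10 * ((a * |c| * sd) * g₁) ≤ 16 / 5 * (201 / 100 * t) :=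
      mul_le_mul hs10 (h1.trans_eq h1') (by positivity) (by norm_num)
    have h4 : Real.sqrt 3 * ((a ^ 2 * c ^ 2 * P.d + b * c ^ 2 * P.d) * A') ≤ 7 / 4 * (201 / 100 * (t ^ 2 + u)) :=
      mul_le_mul hs3 (h2.trans_eq h2') (by positivity) (by norm_num)
    have e3 : 5 / 2 * Real.sqrt 10 * (a * |c| * sd) * g₁ = 5 / 2 * (Real.sqrt 10 * ((a * |c| * sd) * g₁)) := by ring
    have e4 : 2 * Real.sqrt 3 * ((a ^ 2 * c ^ 2 * ↑P.d + b * c ^ 2 * ↑P.d) * A')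
        = 2 * (Real.sqrt 3 * ((a ^ 2 * c ^ 2 * P.d + b * c ^ 2 * P.d) * A')) := by ring
    rw [e3, e4]
    linarith
  -- apply the core estimate and weaken constants
  obtain ⟨hE, hN, hG⟩ := weighted_laplace_le_core c C ω e h s ht ha0 ha hb0 hA hω₀ hω₁ hω₂ hP he hEL hp hγ hA' hg₁ hτ H1 H2
  have hHt0 : 0 ≤ Real.sqrt (∑ b, (ω b.src * ht b) ^ 2) := Real.sqrt_nonneg _
  have hS0 : 0 ≤ Real.sqrt (∑ x, (ω x * s x) ^ 2) := Real.sqrt_nonneg _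
  have hE0 : 0 ≤ Real.sqrt (∑ x, (ω x * laplace c e x) ^ 2) := Real.sqrt_nonneg _
  refine ⟨hE.trans ?_, hN.trans ?_, hG.trans ?_⟩
  · have h1 : 2 * (g₁ + γ * A') ≤ 5 * sA := by linarith
    have h2 : 2 * A' ≤ 5 * A := by linarith
    have h3 := mul_le_mul_of_nonneg_right h1 hHt0
    have h4 := mul_le_mul_of_nonneg_right h2 hS0
    linarith
  · exact mul_le_mul_of_nonneg_right (by linarith) hE0
  · exact mul_le_mul_of_nonneg_right (by linarith) hE0

end Summit.QuantumFields.YangMills.Theorems.Prop7PinnedBiharmonicAgmonWindow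

end
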